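import Summits.Schanuel.Schanuel.Theorems.RootDecomp1JFirstFailureRank

/-!
# The block-size axis of the residual K₃ of route `RootDecomp1J` is a truncation (supports `stmt-Schanuel-30523`)

Part 3 of the lens-3 v11 port (parts 1–2: `RootDecomp1JFirstFailure` = §0–§3, `RootDecomp1JFirstFailureRank` = §4–§5,
census split of `HOME/decomp-schanuel-lens-3/v11/prover/RootDecomp1JFirstFailure.port.lean`). Content = §6 of that file (rev b):

* `hblock_cons_pow` — **padding a hereditary block by a power of one of its coordinates gives a hereditary block**
  (same witness set; a modular-exchange argument — the local block criterion cannot give this, a padded deficient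
  block has a deficient sub-system);
* `BlockExactAt`, `blockExactAt_of_succ`, `blockExactOn_iff_blockExactAt_ge` — over a relatively algebraically
  closed base and a power-closed upper space, block-exactness at sizes `≥ M₀` is all of it, for every `M₀`;
* for the item: **`pK3_iff_size_ge (M₀) : SchanuelOverPairClosedFields ↔ K₃[block size ≥ M₀]`**, `pG2_iff_size_ge`.

With `pK3_iff_rank_ge` (part 2) and `pK3_iff_forall_blockStep` (part 1): the rank, block-size and depth gradings of
K₃ = `SchanuelOverPairClosedFields` (stmt-Schanuel-30523, the route's declared residual) are truncations — kernel
`Iff`s over the live item text — not decompositions. Nothing here proves Schanuel or K₃; the route stays DRAFT.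
Provenance: decomposition cell `decomp-schanuel`, lens 3, gen 10 (NODE v11 addendum).
-/

set_option linter.dupNamespace false

noncomputable section

open Complex IntermediateField
open Literature.Barriers.Schanuel (trdeg_mono)
open Summit.Schanuel.Schanuel.Theorems.RootDecomp1DFlagSplit (trdeg_adjoin_union_eq_add
  trdeg_adjoin_le_cardinalMk trdeg_gens_lt_aleph0 rel_iff_add)
open Summit.Schanuel.Schanuel.Theorems.RootDecomp1JKhovanskiiBlocks (mem_and_isAlgebraic_exp_of_mem_span_set
  trdeg_witnessField_lt_aleph0)
open Summit.Schanuel.Schanuel.Theorems.RootDecomp1JBlockHulls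
open Summit.Schanuel.Schanuel.Theorems.RootDecomp1JGapLemma
open Summit.Schanuel.Schanuel.Theorems.RootDecomp1JRankKernel
open Summit.Schanuel.Schanuel.Theorems.RootDecomp1JFirstFailure
open Summit.Schanuel.Schanuel.Theses.RootDecomp1J

namespace Summit.Schanuel.Schanuel.Theorems.RootDecomp1JFirstFailureSize

open Submodule in
/-- **PADDING A BLOCK BY A POWER.** A hereditary `n`-block `w` over `E` padded by a power `(w i₀)^p` of one
of its coordinates is a hereditary `(n+1)`-block over `E`, with the same witness set. Given `T ⊇ Y` and a
sub-tuple `ρ` of `(g, w̄)` which spans `(g, w̄)` together with `T`: either `g ∈ span_ℚ(T ∪ w̄)` — then `e^g`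
is algebraic over `ℚ(T, w̄, e^T, e^w̄)`, the pair `(g, e^g)` costs nothing, and if `g` was needed to span
`w̄` one more coordinate of `w̄` replaces it (a modular exchange) — or `g ∉ span_ℚ(T ∪ w̄)`, and then `g`
occupies a slot of `ρ`, `w̄` is spanned without it, and `(g, e^g)` costs at most that one slot. [this file] -/
theorem hblock_cons_pow {E : Submodule ℚ ℂ} {n : ℕ} {w : Fin n → ℂ} (hw : HBlock E w) (i₀ : Fin n)
    (p : ℕ) : HBlock E (Fin.cons (w i₀ ^ p) w : Fin (n + 1) → ℂ) := by
  classical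
  obtain ⟨Y, hY, hB⟩ := hw
  refine ⟨Y, hY, fun T hT k ρ hsp => ?_⟩
  set g : ℂ := w i₀ ^ p with hg
  set G : Set ℂ := (↑T : Set ℂ) ∪ cexp '' ↑T with hG
  set A : Set ℂ := Set.range w ∪ Set.range (cexp ∘ w) with hA
  have hfin : Algebra.trdeg ℚ ↥(adjoin ℚ G) < Cardinal.aleph0 := trdeg_witnessField_lt_aleph0 T
  -- (1) the block property of `w̄`, indexed by finite sets of coordinates, in additive form
  have hBset : ∀ S : Finset (Fin n), (∀ j, w j ∈ span ℚ ((↑T : Set ℂ) ∪ w '' ↑S)) →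
      Algebra.trdeg ℚ ↥(adjoin ℚ (G ∪ A)) ≤ Algebra.trdeg ℚ ↥(adjoin ℚ G) + (S.card : Cardinal) := by
    intro S hS
    refine (rel_le_iff_add G A hfin S.card).mp ?_
    let ρ' : Fin S.card → Fin n := fun i => ((S.equivFin.symm i : {x // x ∈ S}) : Fin n)
    have hrange : Set.range (w ∘ ρ') = w '' ↑S := by
      ext x
      constructor
      · rintro ⟨i, rfl⟩
        exact ⟨_, (S.equivFin.symm i).2, rfl⟩
      · rintro ⟨j, hj, rfl⟩
        refine ⟨S.equivFin ⟨j, hj⟩, ?_⟩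
        show w ((S.equivFin.symm (S.equivFin ⟨j, hj⟩) : {x // x ∈ S}) : Fin n) = w j
        rw [Equiv.symm_apply_apply]
    exact hB T hT S.card ρ' (by rw [hrange]; exact hS)
  -- (2) the coordinates of `w̄` selected by `ρ`
  set S₀ : Finset (Fin n) := Finset.univ.filter (fun j : Fin n => j.succ ∈ Set.range ρ) with hS₀
  have hmemS₀ : ∀ j : Fin n, j ∈ S₀ ↔ ∃ i, ρ i = j.succ := by
    intro j
    rw [hS₀, Finset.mem_filter]
    simp only [Finset.mem_univ, true_and, Set.mem_range]
  have hsub : Set.range ((Fin.cons g w : Fin (n + 1) → ℂ) ∘ ρ) ⊆ insert g (w '' ↑S₀) := by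
    rintro x ⟨i, rfl⟩
    rcases Fin.eq_zero_or_eq_succ (ρ i) with h0 | ⟨j, hj⟩
    · rw [Function.comp_apply, h0, Fin.cons_zero]; exact Set.mem_insert _ _
    · refine Set.mem_insert_of_mem _ ⟨j, ?_, ?_⟩
      · rw [Finset.mem_coe, hmemS₀]; exact ⟨i, hj⟩
      · rw [Function.comp_apply, hj, Fin.cons_succ]
  have hsub0 : (0 : Fin (n + 1)) ∉ Set.range ρ →
      Set.range ((Fin.cons g w : Fin (n + 1) → ℂ) ∘ ρ) ⊆ w '' ↑S₀ := by
    rintro h0 x ⟨i, rfl⟩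
    rcases Fin.eq_zero_or_eq_succ (ρ i) with h | ⟨j, hj⟩
    · exact absurd ⟨i, h⟩ h0
    · refine ⟨j, ?_, ?_⟩
      · rw [Finset.mem_coe, hmemS₀]; exact ⟨i, hj⟩
      · rw [Function.comp_apply, hj, Fin.cons_succ]
  have himage : S₀.map (Fin.succEmb n) ⊆ Finset.univ.image ρ := by
    intro x hx
    rw [Finset.mem_map] at hx
    obtain ⟨j, hj, rfl⟩ := hx
    obtain ⟨i, hi⟩ := (hmemS₀ j).mp hj
    exact Finset.mem_image.mpr ⟨i, Finset.mem_univ _, hi⟩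
  have hcardρ : (Finset.univ.image ρ).card ≤ k :=
    Finset.card_image_le.trans (by rw [Finset.card_univ, Fintype.card_fin])
  have hcard : S₀.card ≤ k := by
    have h1 := Finset.card_le_card himage
    rw [Finset.card_map] at h1
    exact h1.trans hcardρ
  have hcard0 : (0 : Fin (n + 1)) ∈ Set.range ρ → S₀.card + 1 ≤ k := by
    rintro ⟨i₁, hi₁⟩
    have h0 : (0 : Fin (n + 1)) ∉ S₀.map (Fin.succEmb n) := by
      rw [Finset.mem_map]
      rintro ⟨j, -, hj⟩
      exact Fin.succ_ne_zero j hj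
    have h1 : (insert (0 : Fin (n + 1)) (S₀.map (Fin.succEmb n))).card ≤ (Finset.univ.image ρ).card := by
      refine Finset.card_le_card (Finset.insert_subset_iff.mpr ⟨?_, himage⟩)
      exact Finset.mem_image.mpr ⟨i₁, Finset.mem_univ _, hi₁⟩
    rw [Finset.card_insert_of_notMem h0, Finset.card_map] at h1
    exact h1.trans hcardρ
  -- (3) where the coordinates lie
  have hgW : g ∈ span ℚ ((↑T : Set ℂ) ∪ Set.range ((Fin.cons g w : Fin (n + 1) → ℂ) ∘ ρ)) := by
    have h := hsp 0
    rwa [Fin.cons_zero] at h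
  have hwW : ∀ j, w j ∈ span ℚ ((↑T : Set ℂ) ∪ Set.range ((Fin.cons g w : Fin (n + 1) → ℂ) ∘ ρ)) := by
    intro j
    have h := hsp j.succ
    rwa [Fin.cons_succ] at h
  have hWle : span ℚ ((↑T : Set ℂ) ∪ Set.range ((Fin.cons g w : Fin (n + 1) → ℂ) ∘ ρ)) ≤
      span ℚ (insert g ((↑T : Set ℂ) ∪ w '' ↑S₀)) := by
    refine span_mono ?_
    rintro x (hx | hx)
    · exact Set.mem_insert_of_mem _ (Set.mem_union_left _ hx)
    · rcases (Set.mem_insert_iff.mp (hsub hx)) with h | h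
      · rw [h]; exact Set.mem_insert _ _
      · exact Set.mem_insert_of_mem _ (Set.mem_union_right _ h)
  -- the modular exchange: if `w j₁` is not spanned without `g`, then `g` is spanned with `w j₁` instead
  have hmod : ∀ j₁, w j₁ ∉ span ℚ ((↑T : Set ℂ) ∪ w '' ↑S₀) →
      g ∈ span ℚ (insert (w j₁) ((↑T : Set ℂ) ∪ w '' ↑S₀)) := by
    intro j₁ hj₁
    obtain ⟨a, ha⟩ := mem_span_insert'.mp (hWle (hwW j₁))
    have ha0 : a ≠ 0 := by
      rintro rfl
      rw [zero_smul, add_zero] at ha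
      exact hj₁ ha
    refine mem_span_insert'.mpr ⟨a⁻¹, ?_⟩
    have h := (span ℚ ((↑T : Set ℂ) ∪ w '' ↑S₀)).smul_mem a⁻¹ ha
    rwa [smul_add, inv_smul_smul₀ ha0, add_comm] at h
  -- (4) the cost of the pair `(g, e^g)` over `L₀ = ℚ(T, w̄, e^T, e^w̄)`
  set L₀ : IntermediateField ℚ ℂ := adjoin ℚ (G ∪ A) with hL₀
  have hgL₀ : g ∈ L₀ := by
    have h : w i₀ ∈ L₀ := subset_adjoin _ _ (Or.inr (Or.inl ⟨i₀, rfl⟩))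
    rw [hg]
    exact pow_mem h p
  have hgalg : IsAlgebraic L₀ g := isAlgebraic_algebraMap (⟨g, hgL₀⟩ : ↥L₀)
  have hextra1 : Algebra.trdeg ↥L₀ ↥(adjoin ↥L₀ ({g, cexp g} : Set ℂ)) ≤ 1 :=
    reltrdeg_pair_le_one_of_isAlgebraic L₀ hgalg
  have hextra0 : g ∈ span ℚ ((↑T : Set ℂ) ∪ Set.range w) →
      Algebra.trdeg ↥L₀ ↥(adjoin ↥L₀ ({g, cexp g} : Set ℂ)) = 0 := by
    intro hgU
    have hle : adjoin ℚ (((↑T : Set ℂ) ∪ Set.range w) ∪ cexp '' ((↑T : Set ℂ) ∪ Set.range w)) ≤ L₀ := by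
      refine adjoin.mono ℚ _ _ ?_
      rintro x ((hx | ⟨j, rfl⟩) | ⟨t, ht, rfl⟩)
      · exact Or.inl (Or.inl hx)
      · exact Or.inr (Or.inl ⟨j, rfl⟩)
      · rcases ht with ht | ⟨j, rfl⟩
        · exact Or.inl (Or.inr ⟨t, ht, rfl⟩)
        · exact Or.inr (Or.inr ⟨j, rfl⟩)
    have hexp : IsAlgebraic L₀ (cexp g) := (mem_and_isAlgebraic_exp_of_mem_span_set hgU L₀ hle).2
    refine reltrdeg_eq_zero_of_isAlgebraic L₀ _ ?_
    rintro x (rfl | hx)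
    · exact hgalg
    · rw [Set.mem_singleton_iff.mp hx]; exact hexp
  -- (5) the generated set of the padded tuple and the tower over `L₀`
  have hset : Set.range (Fin.cons g w : Fin (n + 1) → ℂ) ∪
      Set.range (cexp ∘ (Fin.cons g w : Fin (n + 1) → ℂ)) = A ∪ {g, cexp g} := by
    rw [Fin.comp_cons, Fin.range_cons, Fin.range_cons, hA]
    ext x
    simp only [Set.mem_union, Set.mem_insert_iff, Set.mem_singleton_iff]
    tauto
  rw [hset]
  refine (rel_le_iff_add G (A ∪ {g, cexp g}) hfin k).mpr ?_
  have htower : Algebra.trdeg ℚ ↥(adjoin ℚ (G ∪ (A ∪ {g, cexp g}))) =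
      Algebra.trdeg ℚ ↥L₀ + Algebra.trdeg ↥L₀ ↥(adjoin ↥L₀ ({g, cexp g} : Set ℂ)) := by
    rw [← Set.union_assoc, hL₀]
    exact trdeg_adjoin_union_eq_add (K := ℚ) _ _
  rw [htower]
  -- (6) the dichotomy
  by_cases hgU : g ∈ span ℚ ((↑T : Set ℂ) ∪ Set.range w)
  · rw [hextra0 hgU, add_zero]
    by_cases hall : ∀ j, w j ∈ span ℚ ((↑T : Set ℂ) ∪ w '' ↑S₀)
    · exact (hBset S₀ hall).trans (add_le_add le_rfl (by exact_mod_cast hcard))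
    · push Not at hall
      obtain ⟨j₁, hj₁⟩ := hall
      have hgX := hmod j₁ hj₁
      have h0 : (0 : Fin (n + 1)) ∈ Set.range ρ := by
        by_contra h0
        refine hj₁ (span_mono ?_ (hwW j₁))
        rintro x (hx | hx)
        · exact Or.inl hx
        · exact Or.inr (hsub0 h0 hx)
      have hj₁S : j₁ ∉ S₀ := fun h =>
        hj₁ (subset_span (Or.inr ⟨j₁, Finset.mem_coe.mpr h, rfl⟩))
      have hall' : ∀ j, w j ∈ span ℚ ((↑T : Set ℂ) ∪ w '' ↑(insert j₁ S₀)) := by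
        have hle : span ℚ (insert g ((↑T : Set ℂ) ∪ w '' ↑S₀)) ≤
            span ℚ ((↑T : Set ℂ) ∪ w '' ↑(insert j₁ S₀)) := by
          refine span_le.mpr ?_
          rintro x hx
          rcases Set.mem_insert_iff.mp hx with rfl | hx
          · refine span_mono ?_ hgX
            rintro y hy
            rcases Set.mem_insert_iff.mp hy with rfl | (hy | ⟨j, hj, rfl⟩)
            · exact Or.inr ⟨j₁, Finset.mem_coe.mpr (Finset.mem_insert_self _ _), rfl⟩
            · exact Or.inl hy
            · exact Or.inr ⟨j, Finset.mem_coe.mpr (Finset.mem_insert_of_mem (Finset.mem_coe.mp hj)), rfl⟩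
          · refine subset_span ?_
            rcases hx with hx | ⟨j, hj, rfl⟩
            · exact Or.inl hx
            · exact Or.inr ⟨j, Finset.mem_coe.mpr (Finset.mem_insert_of_mem (Finset.mem_coe.mp hj)), rfl⟩
        exact fun j => hle (hWle (hwW j))
      have hc : (insert j₁ S₀).card = S₀.card + 1 := Finset.card_insert_of_notMem hj₁S
      calc Algebra.trdeg ℚ ↥L₀
          ≤ Algebra.trdeg ℚ ↥(adjoin ℚ G) + ((insert j₁ S₀).card : Cardinal) := hBset _ hall'
        _ ≤ Algebra.trdeg ℚ ↥(adjoin ℚ G) + (k : Cardinal) := by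
            rw [hc]
            exact add_le_add le_rfl (by exact_mod_cast hcard0 h0)
  · have h0 : (0 : Fin (n + 1)) ∈ Set.range ρ := by
      by_contra h0
      refine hgU (span_mono ?_ hgW)
      rintro x (hx | hx)
      · exact Or.inl hx
      · obtain ⟨j, -, rfl⟩ := hsub0 h0 hx
        exact Or.inr ⟨j, rfl⟩
    have hall : ∀ j, w j ∈ span ℚ ((↑T : Set ℂ) ∪ w '' ↑S₀) := by
      by_contra hall
      push Not at hall
      obtain ⟨j₁, hj₁⟩ := hall
      refine hgU (span_mono ?_ (hmod j₁ hj₁))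
      rintro y hy
      rcases Set.mem_insert_iff.mp hy with rfl | (hy | ⟨j, -, rfl⟩)
      · exact Or.inr ⟨j₁, rfl⟩
      · exact Or.inl hy
      · exact Or.inr ⟨j, rfl⟩
    calc Algebra.trdeg ℚ ↥L₀ + Algebra.trdeg ↥L₀ ↥(adjoin ↥L₀ ({g, cexp g} : Set ℂ))
        ≤ (Algebra.trdeg ℚ ↥(adjoin ℚ G) + (S₀.card : Cardinal)) + 1 :=
          add_le_add (hBset S₀ hall) hextra1
      _ = Algebra.trdeg ℚ ↥(adjoin ℚ G) + ((S₀.card + 1 : ℕ) : Cardinal) := by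
          push_cast
          rw [add_assoc]
      _ ≤ Algebra.trdeg ℚ ↥(adjoin ℚ G) + (k : Cardinal) :=
          add_le_add le_rfl (by exact_mod_cast hcard0 h0)

/-- `BlockExactAt E E'' n`: `BlockExactOn E E''` at block size exactly `n`. -/
def BlockExactAt (E E'' : Submodule ℚ ℂ) (n : ℕ) : Prop :=
  ∀ (w : Fin n → ℂ), (∀ j, w j ∈ E'') → HBlock E w → LinearIndependent ℚ (E.mkQ ∘ w) →
    ∀ (k : ℕ) (y : Fin k → ℂ), (∀ i, y i ∈ E) →
      (n : Cardinal) ≤ Algebra.trdeg ↥(adjoin ℚ (Set.range y ∪ Set.range (cexp ∘ y)))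
        ↥(adjoin ↥(adjoin ℚ (Set.range y ∪ Set.range (cexp ∘ y))) (Set.range w ∪ Set.range (cexp ∘ w)))

/-- `BlockExactOn` is block-exactness at every size (by `Iff.rfl`). -/
theorem blockExactOn_iff_forall_blockExactAt (E E'' : Submodule ℚ ℂ) :
    BlockExactOn E E'' ↔ ∀ n, BlockExactAt E E'' n := Iff.rfl

/-- Size `0` is trivial. -/
theorem blockExactAt_zero (E E'' : Submodule ℚ ℂ) : BlockExactAt E E'' 0 :=
  fun w _ _ _ k y _ => by simp

/-- **SIZE ESCALATION.** Over a relatively algebraically closed `E` and an upper space closed under powers,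
block-exactness at size `n + 1` implies it at size `n ≥ 1`: an over-determined free `n`-block padded by a
free power (`exists_pow_free`, `hblock_cons_pow`, `trdeg_cons_pow_le`) is an over-determined free
`(n+1)`-block. -/
theorem blockExactAt_of_succ {E E'' : Submodule ℚ ℂ} (hE : RelAlgClosed E)
    (hE'' : ∀ x ∈ E'', ∀ p : ℕ, x ^ p ∈ E'') {n : ℕ} (hn : 1 ≤ n) (h : BlockExactAt E E'' (n + 1)) :
    BlockExactAt E E'' n := by
  intro w hwE hBw hw k y hy
  obtain ⟨p, -, hfree⟩ := exists_pow_free hE hw ⟨0, hn⟩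
  have hgE : ∀ j, (Fin.cons (w ⟨0, hn⟩ ^ p) w : Fin (n + 1) → ℂ) j ∈ E'' := by
    intro j
    refine Fin.cases ?_ (fun i => ?_) j
    · rw [Fin.cons_zero]; exact hE'' _ (hwE _) p
    · rw [Fin.cons_succ]; exact hwE i
  have H := h (Fin.cons (w ⟨0, hn⟩ ^ p) w) hgE (hblock_cons_pow hBw ⟨0, hn⟩ p) hfree k y hy
  have hfin := trdeg_gens_lt_aleph0 y
  have H' := (rel_iff_add _ _ hfin (n + 1)).mp H
  have hpad := trdeg_cons_pow_le y w ⟨0, hn⟩ p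
  refine (rel_iff_add _ _ hfin n).mpr ((Cardinal.add_nat_le_add_nat_iff 1).mp ?_)
  calc Algebra.trdeg ℚ ↥(adjoin ℚ (Set.range y ∪ Set.range (cexp ∘ y))) + (n : Cardinal) +
        ((1 : ℕ) : Cardinal)
      = Algebra.trdeg ℚ ↥(adjoin ℚ (Set.range y ∪ Set.range (cexp ∘ y))) + ((n + 1 : ℕ) : Cardinal) := by
        push_cast; rw [add_assoc]
    _ ≤ _ := H'
    _ ≤ _ := hpad
    _ = Algebra.trdeg ℚ ↥(adjoin ℚ ((Set.range y ∪ Set.range (cexp ∘ y)) ∪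
          (Set.range w ∪ Set.range (cexp ∘ w)))) + ((1 : ℕ) : Cardinal) := by rw [Nat.cast_one]

/-- **THE BLOCK-SIZE AXIS IS A TRUNCATION AXIS.** Over a relatively algebraically closed base and an upper
space closed under powers, `BlockExactOn E E'' ↔` block-exactness at sizes `≥ M₀` — for EVERY `M₀`. -/
theorem blockExactOn_iff_blockExactAt_ge {E E'' : Submodule ℚ ℂ} (hE : RelAlgClosed E)
    (hE'' : ∀ x ∈ E'', ∀ p : ℕ, x ^ p ∈ E'') (M₀ : ℕ) :
    BlockExactOn E E'' ↔ ∀ n, M₀ ≤ n → BlockExactAt E E'' n := by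
  refine ⟨fun h n _ => h n, fun h n => ?_⟩
  have hdown : ∀ d m, M₀ = m + d → 1 ≤ m → BlockExactAt E E'' m := by
    intro d
    induction d with
    | zero => intro m hm _; exact h m (by omega)
    | succ d ih => intro m hm h1; exact blockExactAt_of_succ hE hE'' h1 (ih (m + 1) (by omega) (by omega))
  rcases Nat.eq_zero_or_pos n with rfl | hn
  · exact blockExactAt_zero E E''
  · rcases Nat.lt_or_ge n M₀ with hlt | hge
    · exact hdown (M₀ - n) n (by omega) hn
    · exact h n hge

/-- **`K₃ ↔ K₃[block size ≥ M₀]` for every `M₀`:** `SchanuelOverPairClosedFields ↔` every `ℚ`-free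
hereditary block over `𝓚₂` of size `≥ M₀` is exact. With `pK3_iff_rank_ge` and `pK3_iff_forall_blockStep`:
the rank, block-size and depth gradings of the residual K₃ are truncations, not decompositions. -/
theorem pK3_iff_size_ge (M₀ : ℕ) :
    SchanuelOverPairClosedFields ↔ ∀ n, M₀ ≤ n → BlockExactAt ((⨆ n : ℕ, (fun E : Submodule ℚ ℂ => E ⊔ Submodule.span ℚ {x : ℂ | ∃ N : ℕ, N ≤ 2 ∧ ∃ w : Fin N → ℂ, (∃ Y : Finset ℂ, (↑Y : Set ℂ) ⊆ ↑E ∧ ∀ T : Finset ℂ, Y ⊆ T → ∀ (r : ℕ) (ρ : Fin r → Fin N), (∀ j, w j ∈ Submodule.span ℚ ((↑T : Set ℂ) ∪ Set.range (w ∘ ρ))) → Algebra.trdeg ↥(IntermediateField.adjoin ℚ ((↑T : Set ℂ) ∪ Complex.exp '' ↑T)) ↥(IntermediateField.adjoin ↥(IntermediateField.adjoin ℚ ((↑T : Set ℂ) ∪ Complex.exp '' ↑T)) (Set.range w ∪ Set.range (Complex.exp ∘ w))) ≤ r) ∧ x ∈ Set.range w})^[n + 1] (⨆ n : ℕ, (fun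 E : Submodule ℚ ℂ => E ⊔ Submodule.span ℚ {g : ℂ | ∃ Y : Finset ℂ, (↑Y : Set ℂ) ⊆ ↑E ∧ Algebra.trdeg ↥(IntermediateField.adjoin ℚ ((↑Y : Set ℂ) ∪ Complex.exp '' ↑Y)) ↥(IntermediateField.adjoin ↥(IntermediateField.adjoin ℚ ((↑Y : Set ℂ) ∪ Complex.exp '' ↑Y)) ({g, Complex.exp g} : Set ℂ)) ≤ 1})^[n + 1] (⨆ n : ℕ, (fun E : Submodule ℚ ℂ => (E ⊔ Submodule.span ℚ (Complex.exp '' ↑E)) ⊔ Submodule.span ℚ (Complex.exp ⁻¹' ↑(E ⊔ Submodule.span ℚ (Complex.exp '' ↑E))))^[n + 1] (Submodule.span ℚ ({z : ℂ | IsAlgebraic ℚ z} ∪ {z : ℂ | ∃ β l : ℂ, IsAlgebraic ℚ β ∧ IsAlgebraic ℚ (Complex.exp l) ∧ z = β * l})))))) ⊤ n :=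
  pK3_iff_blockExactOn.trans
    (blockExactOn_iff_blockExactAt_ge relAlgClosed_pairHullLit (fun _ _ _ => Submodule.mem_top) M₀)

/-- `G₂ ↔ G₂[block size ≥ M₀]` for every `M₀`. -/
theorem pG2_iff_size_ge (M₀ : ℕ) :
    PairBlocksOverCurveClosedFields ↔ ∀ n, M₀ ≤ n → BlockExactAt ((⨆ n : ℕ, (fun E : Submodule ℚ ℂ => E ⊔ Submodule.span ℚ {g : ℂ | ∃ Y : Finset ℂ, (↑Y : Set ℂ) ⊆ ↑E ∧ Algebra.trdeg ↥(IntermediateField.adjoin ℚ ((↑Y : Set ℂ) ∪ Complex.exp '' ↑Y)) ↥(IntermediateField.adjoin ↥(IntermediateField.adjoin ℚ ((↑Y : Set ℂ) ∪ Complex.exp '' ↑Y)) ({g, Complex.exp g} : Set ℂ)) ≤ 1})^[n + 1] (⨆ n : ℕ, (fun E : Submodule ℚ ℂ => (E ⊔ Submodule.span ℚ (Complex.exp '' ↑E)) ⊔ Submodule.span ℚ (Complex.exp ⁻¹' ↑(E ⊔ Submodule.span ℚ (Complex.exp '' ↑E))))^[n + 1] (Submodule.span ℚ ({z : ℂ |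 IsAlgebraic ℚ z} ∪ {z : ℂ | ∃ β l : ℂ, IsAlgebraic ℚ β ∧ IsAlgebraic ℚ (Complex.exp l) ∧ z = β * l}))))) ((⨆ n : ℕ, (fun E : Submodule ℚ ℂ => E ⊔ Submodule.span ℚ {x : ℂ | ∃ N : ℕ, N ≤ 2 ∧ ∃ w : Fin N → ℂ, (∃ Y : Finset ℂ, (↑Y : Set ℂ) ⊆ ↑E ∧ ∀ T : Finset ℂ, Y ⊆ T → ∀ (r : ℕ) (ρ : Fin r → Fin N), (∀ j, w j ∈ Submodule.span ℚ ((↑T : Set ℂ) ∪ Set.range (w ∘ ρ))) → Algebra.trdeg ↥(IntermediateField.adjoin ℚ ((↑T : Set ℂ) ∪ Complex.exp '' ↑T)) ↥(IntermediateField.adjoin ↥(IntermediateField.adjoin ℚ ((↑T : Set ℂ) ∪ Complex.exp '' ↑T)) (Set.range w ∪ Set.range (Complex.exp ∘ w))) ≤ r) ∧ x ∈ Set.range w})^[n + 1] (⨆ n : ℕ, (fun E : Submodule ℚ ℂ => E ⊔ Submodule.span ℚ {g : ℂ | ∃ Y : Finset ℂ, (↑Y : Set ℂ) ⊆ ↑E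 ∧ Algebra.trdeg ↥(IntermediateField.adjoin ℚ ((↑Y : Set ℂ) ∪ Complex.exp '' ↑Y)) ↥(IntermediateField.adjoin ↥(IntermediateField.adjoin ℚ ((↑Y : Set ℂ) ∪ Complex.exp '' ↑Y)) ({g, Complex.exp g} : Set ℂ)) ≤ 1})^[n + 1] (⨆ n : ℕ, (fun E : Submodule ℚ ℂ => (E ⊔ Submodule.span ℚ (Complex.exp '' ↑E)) ⊔ Submodule.span ℚ (Complex.exp ⁻¹' ↑(E ⊔ Submodule.span ℚ (Complex.exp '' ↑E))))^[n + 1] (Submodule.span ℚ ({z : ℂ | IsAlgebraic ℚ z} ∪ {z : ℂ | ∃ β l : ℂ, IsAlgebraic ℚ β ∧ IsAlgebraic ℚ (Complex.exp l) ∧ z = β * l})))))) n :=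
  pG2_iff_blockExactOn.trans
    (blockExactOn_iff_blockExactAt_ge relAlgClosed_curveHullLit
      (fun _ hx p => relAlgClosed_pairHullLit.pow_mem hx p) M₀)

end Summit.Schanuel.Schanuel.Theorems.RootDecomp1JFirstFailureSize

end
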